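/-
Origin: expansion seat `planner-pub-hodgecm-mc-theta-3-g13-0`, handover (TD) 2026-08-20T08:13:37Z md5 e1a39fe57a338a21c2338e026a4a9668 (126 l.; NEW additive drop-alone leaf over RUN-44 (TT) `ArchSlotBoxTorusType` + RUN-41 #1212 `ThetaAdelicSideReadOff`; (J-μ) hΔ₁ discharged in E's shape via μ♯ = update (μ c) 1 (μ c 0 + slotDelta c.D); cert rc 0/0 warn/0 proof holes; axioms 9/9 ⊆ trio) (`HOME/mc/pub-hodgecm-mc-theta-3-g13/lean/stage45/HodgeCM/Model/ArchSlotDeltaDischarge.lean`, md5 e1a39fe57a33, 126 lines);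
landed by the gen-17 packager (p-g17) in gate run 45 as `HodgeCM/Model/ArchSlotDeltaDischarge.lean` (verbatim).
-/
/-
Origin: speedrun cell pub-hodgecm, MODEL-CONSTRUCTION sub-cell, lineage mc-theta-3 (theta supply / second-lift lane, BINDER-OWNERS row 5 `S` slot),
seat planner-pub-hodgecm-mc-theta-3-g13-0 (gen 13), 2026-08-20.  Target in PKG: `HodgeCM/Model/ArchSlotDeltaDischarge.lean`
(NEW additive drop-alone leaf; imports this seat's RUN-44 (TT) `Model/ArchSlotBoxTorusType` and sinst-1's RUN-41 #1212 `Model/ThetaAdelicSideReadOff`).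
KERNEL only: 0 records / `def … : Prop` / cites, 0 proof holes; intended closure {propext, Classical.choice, Quot.sound}.
-/
import Summits.HodgeConjecture.HodgeCM.Model.ArchSlotBoxTorusType_2
import Summits.HodgeConjecture.HodgeCM.Model.ThetaAdelicSideReadOff

/-!
# (J-μ) `hΔ₁` DISCHARGED IN E's OWN SHAPE: the adapter `μ♯`

E's (J-μ) binder group of record (#395 / #1212 `SInstance.SROG`, glue-1's `_r21AEOGIS…` chain) is
`μ : SeesawCtx L → Fin 4 → InfinitePlace L → ℤ` (data) with three guarded integer identities
`hΔₖ : ∀ V c, ∀ hc : GOG V c, slotTypeVec … k − slotTypeVec … 0 = μ c k − μ c 0` (`k = 1, 2, 3`).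
(TT) `slotTypeVec_one_sub_zero_eq_slotDelta` computes the `k = 1` difference in closed form (`slotDelta c.D`, `V`-free).  This leaf
packages that as a ONE-LINE DISCHARGE of the binder `hΔ₁` WITHOUT touching `hΔ₂`, `hΔ₃`: replace the datum `μ` by
**`μ♯ c := Function.update (μ c) 1 (μ c 0 + slotDelta c.D)`** (`muSharp`); then

* `hΔ₁_GOG_muSharp` : `hΔ₁` holds at `μ♯` — hypothesis-free (the guard's `hG_GOG`, `hpos_GOG` feed (TT));
* `hΔ_muSharp_of_ne_one` : for `k ≠ 1` the identity `hΔₖ` at `μ♯` IS the identity at `μ` (the update does not touch `0, 2, 3`),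
  specialised as `hΔ₂_GOG_muSharp`, `hΔ₃_GOG_muSharp`.

So an E-shaped term taking `(μ, hΔ₁, hΔ₂, hΔ₃)` is fed `(μ♯, hΔ₁_GOG_muSharp …, hΔ₂_GOG_muSharp μ hΔ₂, hΔ₃_GOG_muSharp μ hΔ₃)`: one binder
group fewer, `μ hΔ₂ hΔ₃` kept verbatim.  Nothing here is a claim of PerL/QW8; nothing is cited.
-/

set_option autoImplicit false

noncomputable section

open scoped Matrix Classical
open Literature.NumberTheory.Automorphic Literature.NumberTheory.Weil1964
open Literature.NumberTheory.GelbartRogawski1991.UnitaryDualPair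
open HodgeCM.Adelic HodgeCM.PerL34
open HodgeCM.Model.HypCensus

namespace HodgeCM.Model.ArchSideTerm

/-- **`μ♯`**: E's slot table with entry `1` re-set to `μ c 0 + slotDelta c.D`. -/
def muSharp (μ : ∀ {L : CMField}, SeesawCtx L → Fin 4 → NumberField.InfinitePlace L → ℤ) {L : CMField} (c : SeesawCtx L) :
    Fin 4 → NumberField.InfinitePlace (L : Type) → ℤ :=
  Function.update (μ c) 1 (μ c 0 + slotDelta c.D)

/-- (Ported verbatim from the HodgeCMPerL package; no docstring in the source.) -/
theorem muSharp_one (μ : ∀ {L : CMField}, SeesawCtx L → Fin 4 → NumberField.InfinitePlace L → ℤ) {L : CMField} (c : SeesawCtx L) :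
    muSharp μ c 1 = μ c 0 + slotDelta c.D :=
  Function.update_self _ _ _

/-- (Ported verbatim from the HodgeCMPerL package; no docstring in the source.) -/
theorem muSharp_of_ne_one (μ : ∀ {L : CMField}, SeesawCtx L → Fin 4 → NumberField.InfinitePlace L → ℤ) {L : CMField} (c : SeesawCtx L)
    {k : Fin 4} (hk : k ≠ 1) : muSharp μ c k = μ c k :=
  Function.update_of_ne hk _ _

/-- (Ported verbatim from the HodgeCMPerL package; no docstring in the source.) -/
theorem muSharp_one_sub_zero (μ : ∀ {L : CMField}, SeesawCtx L → Fin 4 → NumberField.InfinitePlace L → ℤ) {L : CMField} (c : SeesawCtx L) :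
    muSharp μ c 1 - muSharp μ c 0 = slotDelta c.D := by
  rw [muSharp_one, muSharp_of_ne_one μ c (by decide : (0 : Fin 4) ≠ 1), add_sub_cancel_left]

/-- (Ported verbatim from the HodgeCMPerL package; no docstring in the source.) -/
theorem muSharp_sub_zero_of_ne_one (μ : ∀ {L : CMField}, SeesawCtx L → Fin 4 → NumberField.InfinitePlace L → ℤ) {L : CMField}
    (c : SeesawCtx L) {k : Fin 4} (hk : k ≠ 1) : muSharp μ c k - muSharp μ c 0 = μ c k - μ c 0 := by
  rw [muSharp_of_ne_one μ c hk, muSharp_of_ne_one μ c (by decide : (0 : Fin 4) ≠ 1)]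

section E

variable
  (hGR : ∀ {L : CMField} {ι₁ : L →+* ℂ} (V : HermSpace3 L ι₁) (c : SeesawCtx L),
    (cmSplittingDatum (L : Type) finProdFinEquiv (frameD V) (frameD_real V) (frameD_ne V) (dW c.D) (dW_real c.D)
      (dW_ne c.D)).CompatibleSplitting)
  (hGR₀ : ∀ {L : CMField} {ι₁ : L →+* ℂ} (V : HermSpace3 L ι₁) (c : SeesawCtx L),
    (cmSplittingDatum (L : Type) (e₁) (frameD V) (frameD_real V) (frameD_ne V) (lineVec (L : Type) (dW c.D 0))
      (fun _ => dW_real c.D 0) (fun _ => dW_ne c.D 0)).CompatibleSplitting)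
  (hGR₁ : ∀ {L : CMField} {ι₁ : L →+* ℂ} (V : HermSpace3 L ι₁) (c : SeesawCtx L),
    (cmSplittingDatum (L : Type) (e₁) (frameD V) (frameD_real V) (frameD_ne V) (lineVec (L : Type) (dW c.D 1))
      (fun _ => dW_real c.D 1) (fun _ => dW_ne c.D 1)).CompatibleSplitting)
  (hGR₂ : ∀ {L : CMField} {ι₁ : L →+* ℂ} (V : HermSpace3 L ι₁) (c : SeesawCtx L),
    (cmSplittingDatum (L : Type) (e₁) (frameD V) (frameD_real V) (frameD_ne V) (lineVec (L : Type) (dW' c.D 0))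
      (fun _ => dW'_real c.D 0) (fun _ => dW'_ne c.D 0)).CompatibleSplitting)
  (hGR₃ : ∀ {L : CMField} {ι₁ : L →+* ℂ} (V : HermSpace3 L ι₁) (c : SeesawCtx L),
    (cmSplittingDatum (L : Type) (e₁) (frameD V) (frameD_real V) (frameD_ne V) (lineVec (L : Type) (dW' c.D 1))
      (fun _ => dW'_real c.D 1) (fun _ => dW'_ne c.D 1)).CompatibleSplitting)
  (μ : ∀ {L : CMField}, SeesawCtx L → Fin 4 → NumberField.InfinitePlace L → ℤ)

/-- **`hΔ₁` OF E AT `μ♯` — HYPOTHESIS-FREE** (binder text of #395 / #1212 `SInstance.SROG` verbatim with `μ ↦ μ♯`). -/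
theorem hΔ₁_GOG_muSharp : ∀ {L : CMField} {ι₁ : L →+* ℂ} (V : HermSpace3 L ι₁) (c : SeesawCtx L), ∀ hc : SInstance.GOG V c,
    slotTypeVec V c (hGR V c) (hGR₀ V c) (hGR₁ V c) (hGR₂ V c) (hGR₃ V c) (SInstance.hG_GOG V c hc) 1 -
      slotTypeVec V c (hGR V c) (hGR₀ V c) (hGR₁ V c) (hGR₂ V c) (hGR₃ V c) (SInstance.hG_GOG V c hc) 0 =
        muSharp μ c 1 - muSharp μ c 0 :=
  fun V c hc => (slotTypeVec_one_sub_zero_eq_slotDelta V c (hGR V c) (hGR₀ V c) (hGR₁ V c) (hGR₂ V c) (hGR₃ V c) (SInstance.hG_GOG V c hc)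
    (SInstance.hpos_GOG V c hc).1 (SInstance.hpos_GOG V c hc).2.1).trans (muSharp_one_sub_zero μ c).symm

/-- **`hΔₖ` at `μ♯` from `hΔₖ` at `μ`, `k ≠ 1`.** -/
theorem hΔ_GOG_muSharp_of_ne_one {k : Fin 4} (hk : k ≠ 1)
    (hΔ : ∀ {L : CMField} {ι₁ : L →+* ℂ} (V : HermSpace3 L ι₁) (c : SeesawCtx L), ∀ hc : SInstance.GOG V c,
      slotTypeVec V c (hGR V c) (hGR₀ V c) (hGR₁ V c) (hGR₂ V c) (hGR₃ V c) (SInstance.hG_GOG V c hc) k -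
        slotTypeVec V c (hGR V c) (hGR₀ V c) (hGR₁ V c) (hGR₂ V c) (hGR₃ V c) (SInstance.hG_GOG V c hc) 0 = μ c k - μ c 0) :
    ∀ {L : CMField} {ι₁ : L →+* ℂ} (V : HermSpace3 L ι₁) (c : SeesawCtx L), ∀ hc : SInstance.GOG V c,
      slotTypeVec V c (hGR V c) (hGR₀ V c) (hGR₁ V c) (hGR₂ V c) (hGR₃ V c) (SInstance.hG_GOG V c hc) k -
        slotTypeVec V c (hGR V c) (hGR₀ V c) (hGR₁ V c) (hGR₂ V c) (hGR₃ V c) (SInstance.hG_GOG V c hc) 0 =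
          muSharp μ c k - muSharp μ c 0 :=
  fun V c hc => (hΔ V c hc).trans (muSharp_sub_zero_of_ne_one μ c hk).symm

/-- `hΔ₂` at `μ♯` from `hΔ₂` at `μ`. -/
theorem hΔ₂_GOG_muSharp
    (hΔ₂ : ∀ {L : CMField} {ι₁ : L →+* ℂ} (V : HermSpace3 L ι₁) (c : SeesawCtx L), ∀ hc : SInstance.GOG V c,
      slotTypeVec V c (hGR V c) (hGR₀ V c) (hGR₁ V c) (hGR₂ V c) (hGR₃ V c) (SInstance.hG_GOG V c hc) 2 -
        slotTypeVec V c (hGR V c) (hGR₀ V c) (hGR₁ V c) (hGR₂ V c) (hGR₃ V c) (SInstance.hG_GOG V c hc) 0 = μ c 2 - μ c 0) :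
    ∀ {L : CMField} {ι₁ : L →+* ℂ} (V : HermSpace3 L ι₁) (c : SeesawCtx L), ∀ hc : SInstance.GOG V c,
      slotTypeVec V c (hGR V c) (hGR₀ V c) (hGR₁ V c) (hGR₂ V c) (hGR₃ V c) (SInstance.hG_GOG V c hc) 2 -
        slotTypeVec V c (hGR V c) (hGR₀ V c) (hGR₁ V c) (hGR₂ V c) (hGR₃ V c) (SInstance.hG_GOG V c hc) 0 =
          muSharp μ c 2 - muSharp μ c 0 :=
  hΔ_GOG_muSharp_of_ne_one hGR hGR₀ hGR₁ hGR₂ hGR₃ μ (by decide) hΔ₂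

/-- `hΔ₃` at `μ♯` from `hΔ₃` at `μ`. -/
theorem hΔ₃_GOG_muSharp
    (hΔ₃ : ∀ {L : CMField} {ι₁ : L →+* ℂ} (V : HermSpace3 L ι₁) (c : SeesawCtx L), ∀ hc : SInstance.GOG V c,
      slotTypeVec V c (hGR V c) (hGR₀ V c) (hGR₁ V c) (hGR₂ V c) (hGR₃ V c) (SInstance.hG_GOG V c hc) 3 -
        slotTypeVec V c (hGR V c) (hGR₀ V c) (hGR₁ V c) (hGR₂ V c) (hGR₃ V c) (SInstance.hG_GOG V c hc) 0 = μ c 3 - μ c 0) :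
    ∀ {L : CMField} {ι₁ : L →+* ℂ} (V : HermSpace3 L ι₁) (c : SeesawCtx L), ∀ hc : SInstance.GOG V c,
      slotTypeVec V c (hGR V c) (hGR₀ V c) (hGR₁ V c) (hGR₂ V c) (hGR₃ V c) (SInstance.hG_GOG V c hc) 3 -
        slotTypeVec V c (hGR V c) (hGR₀ V c) (hGR₁ V c) (hGR₂ V c) (hGR₃ V c) (SInstance.hG_GOG V c hc) 0 =
          muSharp μ c 3 - muSharp μ c 0 :=
  hΔ_GOG_muSharp_of_ne_one hGR hGR₀ hGR₁ hGR₂ hGR₃ μ (by decide) hΔ₃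

end E

end HodgeCM.Model.ArchSideTerm

end
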